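import Summits.BirchSwinnertonDyer.BirchSwinnertonDyer.Theorems.AlignedTransportAtTwoMainConjectureOfRankZeroBSDAtTwoSexticRankCertificate
import Summits.BirchSwinnertonDyer.BirchSwinnertonDyer.Theorems.AlignedTransportAtTwoMainConjectureOfRankZeroBSDAtTwoCubicTowerLambda
import Summits.BirchSwinnertonDyer.BirchSwinnertonDyer.Theorems.AlignedTransportAtTwoMainConjectureOfRankZeroBSDAtTwoGreenbergFieldLambda
import Literature.NumberTheory.IwasawaTheory.ClassicalLambdaLeStableRank
import Literature.NumberTheory.IwasawaTheory.CyclotomicTwoTotallyRamifiedOddIndex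
import HarnessLib

/-!
# Route `AlignedTransportAtTwo`, crux C2 `MainConjectureOfRankZeroBSDAtTwo` (stmt-BirchSwinnertonDyer-22298):
# THE `λ`-SANDWICH OF A RANK CERTIFICATE — `s − 1 − u_K ≤ λ₂ ≤ r`: on the Kilford sub-cell a `2`-rank certificate of value `r` on the sextic `ℚ(W[2])` gives
# `3 ≤ λ₂ ≤ r` (`r = 3 ⟹ λ₂ = 3`), on the cubic `ℚ(β)` and on the Greenberg field `1 ≤ λ₂ ≤ r` (`r = 1 ⟹ λ₂ = 1`)

HONEST FRAMING (cell `bsd-f1-sign2`, WIDTH-5 attached prover seat `bsd-line-att-p3` gen 28, line `birth`, lead `bsd-line-att-p2`; `--supports`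
stmt-BirchSwinnertonDyer-22298, closes nothing; BSD is NOT proved; crux C2, its verdict «blocked-on `Rank1Residual.GreenbergMuConjectureIrreducible`» and every
registered stub (P / T / Kμ / LimDoor / MuIneqʳ / PFμ⁺) untouched).  THEOREMS ONLY — no definition, no named fact, no `sorry`.  Composition of this gen's two files
`…SexticRankCertificate` (p757586: Fukuda propagation, every certificate on the sextic has value `≥ 3`) and `Literature/…/IwasawaTheory/ClassicalLambdaLeStableRank`
(p757860: ★ `classicalLambda_le_of_classGroupPRank_succ_eq` — a Fukuda RANK certificate `r_{n+1} = r_n` gives `λ ≤ r_n`, finite level) with this seat's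
lower bounds `μ = 0 ⟹ λ ≥ s − 1 − u` (g25 `…ZpTowerChevalleyGrowth.le_slope_of_linear_growth_of_rank`, g26 `…SexticTowerLambda` / `…GreenbergFieldLambda`,
g25 `…CubicTowerLambda`).

* §1 GENERIC `p = 2` (`√2 ∈ K_1`, odd indices above `2`, `s ≤ #{w ∣ 2}`): certificate `r_{n+1} = r_n` ⟹ **`s ≤ λ + 1 + u_K` and `λ ≤ r_n`**
  (`classicalLambda_sandwich_of_rankCert`); `θ`-free and `K → ℚ₂` Galois forms.
* §2 THE SEXTIC `ℚ(W[2])` ON the Kilford stratum (`Δ_W < 0`): ★ **`three_le_classicalLambda_and_le_of_rankCert_divisionField_two`** (`3 ≤ λ ≤ r_n`),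
  ★ **`classicalLambda_eq_three_of_rankCert_eq_three_divisionField_two`** (a certificate of the minimal value `3` pins `λ₂(ℚ(W[2])^{cyc}) = 3`); the coinvariant
  door at `(n+i, n+i+1)` with `c < 2^i` gives `3 ≤ λ ≤ c`.
* §3 THE CUBIC `F` (degree `3`, one real place, three places above `2` — the Kilford cubic `ℚ(β)`): certificate ⟹ **`1 ≤ λ ≤ r_n`**, value `1` pins `λ = 1`
  (the `λ`-reading of att-p4's `hRank` ledger / att-p5's H3M⁻).
* §4 THE GREENBERG FIELD (imaginary quadratic, `2` split; cell bsd-2adic): certificate ⟹ **`1 ≤ λ ≤ r_n`**, value `1` pins `λ = 1`.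

READING (C2 input ledger / -data / cell bsd-2adic).  A rank certificate is not only a `μ = 0` witness but a two-sided `λ` measurement; on the sextic the first
admissible value is `3` and it would give `λ₂ = 3` exactly (with `X` then `ℤ₂`-free of rank `3`, paper).  Nothing here is specific to BSD; no class group is computed.
References: [Fukuda1994] Thm. 1 (2), p. 264; [Washington1997] §13.3 Prop. 13.22–13.23, Thm. 13.13; [Lang1990] Ch. 5 §1 Thm. 1.2, Ch. 13 §4 L4.1–4.2; [Gras2003] IV.4.
-/

set_option linter.dupNamespace false
set_option autoImplicit false

noncomputable section
open scoped Classical NumberField nonZeroDivisors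
namespace Summit.BirchSwinnertonDyer.BirchSwinnertonDyer.Theorems.AlignedTransportAtTwoRankCertificateLambda

open NumberField IsDedekindDomain WeierstrassCurve
open Literature.NumberTheory.EllipticCurves.Greenberg1999 Summit.BirchSwinnertonDyer.Rank1Residual.F1Sign2
open Literature.NumberTheory.NumberFields Literature.NumberTheory.GaloisRepresentations
  Literature.NumberTheory.IwasawaTheory Literature.NumberTheory.EllipticCurves
  Summit.BirchSwinnertonDyer.BirchSwinnertonDyer.Theorems.AlignedTransportAtTwoZpTowerChevalleyGrowth
  Summit.BirchSwinnertonDyer.BirchSwinnertonDyer.Theorems.AlignedTransportAtTwoSexticTowerGrowth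
  Summit.BirchSwinnertonDyer.BirchSwinnertonDyer.Theorems.AlignedTransportAtTwoSexticTowerLambda
  Summit.BirchSwinnertonDyer.BirchSwinnertonDyer.Theorems.AlignedTransportAtTwoSexticTowerRank
  Summit.BirchSwinnertonDyer.BirchSwinnertonDyer.Theorems.AlignedTransportAtTwoSexticRankCertificate
  Summit.BirchSwinnertonDyer.BirchSwinnertonDyer.Theorems.AlignedTransportAtTwoCubicLayerOneDoors
  Summit.BirchSwinnertonDyer.BirchSwinnertonDyer.Theorems.AlignedTransportAtTwoCubicTowerLambda
  Summit.BirchSwinnertonDyer.BirchSwinnertonDyer.Theorems.AlignedTransportAtTwoGreenbergFieldLambda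

/-! ## §1 Generic `p = 2`: `s − 1 − u_K ≤ λ ≤ r_n` under a rank certificate -/

section Generic

variable {K : Type} [Field K] [NumberField K]

/-- ★ **The `λ`-sandwich of a rank certificate, `p = 2`.**  `κ` a `ℤ₂`-extension of `K` with `√2 ∈ K_1`, all places above `2` of odd index, `s ≤ #{w ∣ 2}`;
a certificate `rank₂ Cl(K_{n+1}) = rank₂ Cl(K_n)` at any pair.  Then `μ = 0`, **`s ≤ λ + 1 + u_K`** (genus theory along the tower, g25) and **`λ ≤ rank₂ Cl(K_n)`**
(p757860). [cite: Fukuda1994, Thm. 1 (2), p. 264] [cite: Washington1997, §13.3 Prop. 13.23 and Thm. 13.13] [cite: Lang1990, Ch. 13 §4, Lemma 4.1–4.2] -/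
theorem classicalLambda_sandwich_of_rankCert (κ : ZpExtension K 2) {θ₁ : κ.layer 1} (hθ₁ : θ₁ ^ 2 = 2)
    (hodd : ∀ w : HeightOneSpectrum (𝓞 K), ((2 : ℕ) : 𝓞 K) ∈ w.asIdeal → Odd (w.asIdeal.ramificationIdx ℤ))
    {s : ℕ} (hs : s ≤ {w : HeightOneSpectrum (𝓞 K) | ((2 : ℕ) : 𝓞 K) ∈ w.asIdeal}.ncard)
    {n : ℕ} (hcert : classGroupPRank κ (n + 1) = classGroupPRank κ n) :
    ClassicalMuVanishes κ ∧ s ≤ classicalLambda κ + 1 + Units.rank K ∧ classicalLambda κ ≤ classGroupPRank κ n := by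
  haveI : Fact (Nat.Prime 2) := ⟨Nat.prime_two⟩
  obtain ⟨hμ, hle⟩ := classicalLambda_le_of_classGroupPRank_succ_eq κ (totallyRamifiedFrom_zero_of_sq_eq_two κ hθ₁ hodd) (Nat.zero_le n) hcert
  obtain ⟨ν, n₀, hlin⟩ := classicalLambda_spec κ hμ
  exact ⟨hμ, le_slope_of_linear_growth_of_rank κ hθ₁ hodd hs hlin, hle⟩

/-- `θ`-free form: `4 ∤ [K:ℚ]`, `κ` cyclotomic, odd indices, `s ≤ #{w ∣ 2}`, certificate ⟹ `s ≤ λ + 1 + u_K ∧ λ ≤ r_n`.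
[cite: Fukuda1994, Thm. 1 (2), p. 264] [cite: Washington1997, §13.3 Thm. 13.13] -/
theorem classicalLambda_sandwich_of_rankCert_of_not_four_dvd (h4 : ¬ 4 ∣ Module.finrank ℚ K) (κ : ZpExtension K 2) (hκ : κ.IsCyclotomic)
    (hodd : ∀ w : HeightOneSpectrum (𝓞 K), ((2 : ℕ) : 𝓞 K) ∈ w.asIdeal → Odd (w.asIdeal.ramificationIdx ℤ))
    {s : ℕ} (hs : s ≤ {w : HeightOneSpectrum (𝓞 K) | ((2 : ℕ) : 𝓞 K) ∈ w.asIdeal}.ncard)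
    {n : ℕ} (hcert : classGroupPRank κ (n + 1) = classGroupPRank κ n) :
    ClassicalMuVanishes κ ∧ s ≤ classicalLambda κ + 1 + Units.rank K ∧ classicalLambda κ ≤ classGroupPRank κ n := by
  obtain ⟨θ₁, hθ₁⟩ := exists_sq_eq_two_layer_one_of_forall_sq_ne_two h4 (forall_sq_ne_two_of_forall_odd_ramificationIdx hodd) κ hκ
  exact classicalLambda_sandwich_of_rankCert κ hθ₁ hodd hs hcert

/-- **`K → ℚ₂`, Galois form**: `K/ℚ` Galois of degree `d`, `4 ∤ d`, a ring map `K → ℚ₂`, `κ` cyclotomic, certificate at any pair ⟹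
**`d ≤ λ + 1 + u_K` and `λ ≤ r_n`**. [cite: Fukuda1994, Thm. 1 (2), p. 264] [cite: Washington1997, §13.3 Thm. 13.13] [cite: NeukirchANT1999, Ch. II §8] -/
theorem classicalLambda_sandwich_of_rankCert_of_ringHom_padic [IsGalois ℚ K] (h4 : ¬ 4 ∣ Module.finrank ℚ K) (σ₀ : K →+* ℚ_[2])
    (κ : ZpExtension K 2) (hκ : κ.IsCyclotomic) {n : ℕ} (hcert : classGroupPRank κ (n + 1) = classGroupPRank κ n) :
    ClassicalMuVanishes κ ∧ Module.finrank ℚ K ≤ classicalLambda κ + 1 + Units.rank K ∧ classicalLambda κ ≤ classGroupPRank κ n := by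
  haveI : Fact (Nat.Prime 2) := ⟨Nat.prime_two⟩
  have hodd := forall_odd_ramificationIdx_of_isGalois_of_ringHom_padic (p := 2) σ₀
  have hm : Module.finrank ℚ K ≤ {w : HeightOneSpectrum (𝓞 K) | ((2 : ℕ) : 𝓞 K) ∈ w.asIdeal}.ncard :=
    (ncard_eq_finrank_of_isGalois_of_ringHom_padic (p := 2) σ₀).ge
  exact classicalLambda_sandwich_of_rankCert_of_not_four_dvd h4 κ hκ hodd hm hcert

end Generic

/-! ## §2 The sextic `ℚ(W[2])` ON the Kilford stratum: `3 ≤ λ ≤ r`, and `r = 3 ⟹ λ = 3` -/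

section Sextic

open Summit.BirchSwinnertonDyer.BirchSwinnertonDyer.Theorems.AlignedTransportAtTwoKilfordStratumShared

variable (W : WeierstrassCurve ℚ) [W.IsElliptic]

/-- ★ **`3 ≤ λ₂ ≤ r` from a rank certificate on the sextic.**  `W` with no rational `2`-torsion abscissa, `Δ_W < 0`, ON the Kilford stratum; `κ` any cyclotomic
`ℤ₂`-extension of `T = ℚ(W[2])`; IF `rank₂ Cl(T_{n+1}) = rank₂ Cl(T_n)` THEN `μ = 0`, **`3 ≤ classicalLambda κ ≤ rank₂ Cl(T_n)`**.
[cite: Fukuda1994, Thm. 1 (2), p. 264] [cite: Washington1997, §13.3 Prop. 13.23 and Thm. 13.13] [cite: Gras2003, IV.4] -/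
theorem three_le_classicalLambda_and_le_of_rankCert_divisionField_two (ht : ∀ x : ℚ, ¬ HasRationalTwoTorsionX W x) (hΔ : W.Δ < 0)
    (hs : OnKilfordStratumAtTwo W) (κ : ZpExtension (W.divisionField 2) 2) (hκ : κ.IsCyclotomic)
    {n : ℕ} (hcert : classGroupPRank κ (n + 1) = classGroupPRank κ n) :
    ClassicalMuVanishes κ ∧ 3 ≤ classicalLambda κ ∧ classicalLambda κ ≤ classGroupPRank κ n := by
  haveI : NumberField (W.divisionField 2) := NumberField.mk
  haveI : Fact (Nat.Prime 2) := ⟨Nat.prime_two⟩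
  obtain ⟨hμ, h3⟩ := three_le_classicalLambda_of_rankCert_divisionField_two W ht hΔ hs κ hκ hcert
  exact ⟨hμ, h3, (classicalLambda_le_of_classGroupPRank_succ_eq κ (totallyRamifiedFrom_zero_divisionField_two W ht hΔ hs κ hκ)
    (Nat.zero_le n) hcert).2⟩

/-- ★ **A certificate of the minimal value pins `λ₂(ℚ(W[2])^{cyc}) = 3`**: if `rank₂ Cl(T_{n+1}) = rank₂ Cl(T_n) = 3` at some pair then `classicalLambda κ = 3`.
[cite: Fukuda1994, Thm. 1 (2), p. 264] [cite: Washington1997, §13.3 Thm. 13.13] -/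
theorem classicalLambda_eq_three_of_rankCert_eq_three_divisionField_two (ht : ∀ x : ℚ, ¬ HasRationalTwoTorsionX W x) (hΔ : W.Δ < 0)
    (hs : OnKilfordStratumAtTwo W) (κ : ZpExtension (W.divisionField 2) 2) (hκ : κ.IsCyclotomic)
    {n : ℕ} (hcert : classGroupPRank κ (n + 1) = classGroupPRank κ n) (h3 : classGroupPRank κ n = 3) : classicalLambda κ = 3 := by
  obtain ⟨-, hge, hle⟩ := three_le_classicalLambda_and_le_of_rankCert_divisionField_two W ht hΔ hs κ hκ hcert
  omega

/-- **`λ₂ ≤ r − ?`: the certificate value bounds `λ` and the census reads it both ways** — contrapositive: if `classicalLambda κ = l` is known (or bounded below by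
`l`) then no certificate of value `< l` exists: `rank₂ Cl(T_n) < l ⟹ rank₂ Cl(T_{n+1}) ≠ rank₂ Cl(T_n)`. [cite: Fukuda1994, Thm. 1 (2), p. 264] [cite: Washington1997, §13.3 Thm. 13.13] -/
theorem classGroupPRank_succ_ne_of_lt_classicalLambda_divisionField_two (ht : ∀ x : ℚ, ¬ HasRationalTwoTorsionX W x) (hΔ : W.Δ < 0)
    (hs : OnKilfordStratumAtTwo W) (κ : ZpExtension (W.divisionField 2) 2) (hκ : κ.IsCyclotomic)
    {n : ℕ} (hlt : classGroupPRank κ n < classicalLambda κ) : classGroupPRank κ (n + 1) ≠ classGroupPRank κ n := fun hcert ↦ by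
  have := (three_le_classicalLambda_and_le_of_rankCert_divisionField_two W ht hΔ hs κ hκ hcert).2.2
  omega

/-- **The coinvariant door on the sextic, `λ`-form**: a coinvariant index `≤ 2^c` with `c < 2^i` at `(n+i, n+i+1)` gives `μ = 0` and **`3 ≤ λ ≤ c`** (so `c ≥ 3`,
p757586). [cite: Washington1997, §13.3 Prop. 13.22–13.23 and Thm. 13.13] [cite: Fukuda1994, Thm. 1 (proof, p. 264)] -/
theorem three_le_classicalLambda_and_le_of_coinvariant_index_le_divisionField_two (ht : ∀ x : ℚ, ¬ HasRationalTwoTorsionX W x) (hΔ : W.Δ < 0)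
    (hs : OnKilfordStratumAtTwo W) (κ : ZpExtension (W.divisionField 2) 2) (hκ : κ.IsCyclotomic) {n i c : ℕ} (hc : c < 2 ^ i)
    (hco : haveI : NumberField (W.divisionField 2) := NumberField.mk
      ((powMonoidHom 2 : ClassGroup (𝓞 (κ.layer (n + (i + 1)))) →* ClassGroup (𝓞 (κ.layer (n + (i + 1))))).range ⊔
        Subgroup.closure {x | ∃ (σ : (κ.layer (n + (i + 1))) ≃ₐ[W.divisionField 2] (κ.layer (n + (i + 1))))
          (_ : ∀ y : κ.layer (n + (i + 1)), ((y : κ.layer (n + (i + 1))) : AlgebraicClosure (W.divisionField 2)) ∈ κ.layer (n + i) → σ y = y)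
          (x' : ClassGroup (𝓞 (κ.layer (n + (i + 1))))), x = ClassGroup.mulEquiv (AmbiguousClass.intAut σ) x' * x'⁻¹}).index ≤ 2 ^ c) :
    ClassicalMuVanishes κ ∧ 3 ≤ classicalLambda κ ∧ classicalLambda κ ≤ c := by
  haveI : NumberField (W.divisionField 2) := NumberField.mk
  haveI : Fact (Nat.Prime 2) := ⟨Nat.prime_two⟩
  obtain ⟨hμ, hle⟩ := classicalLambda_le_of_coinvariant_index_le κ (totallyRamifiedFrom_zero_divisionField_two W ht hΔ hs κ hκ) (Nat.zero_le n) hc hco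
  exact ⟨hμ, three_le_classicalLambda_divisionField_two W ht hΔ hs κ hκ hμ, hle⟩

variable [W.IsGloballyMinimal]

/-- The `Δ_min ≡ 1 (mod 8)` form (globally minimal `W`, good ordinary at `2`) of `3 ≤ λ ≤ r` under a certificate. [cite: Fukuda1994, Thm. 1 (2), p. 264]
[cite: Serre1973, Ch. II §3.3 Thm. 4] -/
theorem three_le_classicalLambda_and_le_of_rankCert_divisionField_two_of_minimalDiscriminantInt_emod_eight (hord : IsOrdinaryAt W 2)
    (ht : ∀ x : ℚ, ¬ HasRationalTwoTorsionX W x) (hΔ : W.Δ < 0) (h8 : minimalDiscriminantInt W % 8 = 1)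
    (κ : ZpExtension (W.divisionField 2) 2) (hκ : κ.IsCyclotomic) {n : ℕ} (hcert : classGroupPRank κ (n + 1) = classGroupPRank κ n) :
    ClassicalMuVanishes κ ∧ 3 ≤ classicalLambda κ ∧ classicalLambda κ ≤ classGroupPRank κ n :=
  three_le_classicalLambda_and_le_of_rankCert_divisionField_two W ht hΔ ((onKilfordStratumAtTwo_iff_minimalDiscriminantInt_emod_eight W hord).mpr h8) κ hκ hcert

/-- The `Δ_min ≡ 1 (mod 8)` form of «a certificate of value `3` pins `λ = 3`». [cite: Fukuda1994, Thm. 1 (2), p. 264] [cite: Serre1973, Ch. II §3.3 Thm. 4] -/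
theorem classicalLambda_eq_three_of_rankCert_eq_three_divisionField_two_of_minimalDiscriminantInt_emod_eight (hord : IsOrdinaryAt W 2)
    (ht : ∀ x : ℚ, ¬ HasRationalTwoTorsionX W x) (hΔ : W.Δ < 0) (h8 : minimalDiscriminantInt W % 8 = 1)
    (κ : ZpExtension (W.divisionField 2) 2) (hκ : κ.IsCyclotomic) {n : ℕ} (hcert : classGroupPRank κ (n + 1) = classGroupPRank κ n)
    (h3 : classGroupPRank κ n = 3) : classicalLambda κ = 3 :=
  classicalLambda_eq_three_of_rankCert_eq_three_divisionField_two W ht hΔ ((onKilfordStratumAtTwo_iff_minimalDiscriminantInt_emod_eight W hord).mpr h8)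
    κ hκ hcert h3

end Sextic

/-! ## §3 The cubic `F` (degree `3`, one real place, three dyadic places): `1 ≤ λ ≤ r`, `r = 1 ⟹ λ = 1` -/

section Cubic

variable (F : Type) [Field F] [NumberField F]

/-- Fukuda index `0` for the cubic: odd degree, three (hence all, index-one) places above `2`. [cite: Washington1997, §13.1 Lemma 13.3] [cite: Fukuda1994, p. 264] -/
theorem totallyRamifiedFrom_zero_of_cubic (hF : Module.finrank ℚ F = 3)
    (h3 : 3 ≤ {v : HeightOneSpectrum (𝓞 F) | ((2 : ℕ) : 𝓞 F) ∈ v.asIdeal}.ncard) (κ : ZpExtension F 2) (hκ : κ.IsCyclotomic) :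
    TotallyRamifiedFrom κ 0 :=
  totallyRamifiedFrom_zero_of_forall_odd_ramificationIdx (by rw [hF]; norm_num) κ hκ
    (fun w hw => by rw [ramificationIdx_eq_one_of_three_le_ncard F hF h3 w hw]; exact odd_one)

/-- ★ **`1 ≤ λ₂ ≤ r` from a rank certificate on the cubic** (`F` of degree `3` with one real place and three places above `2` — the Kilford cubic `ℚ(β)`,
`Δ_W < 0`): `rank₂ Cl(F_{n+1}) = rank₂ Cl(F_n)` ⟹ `μ = 0`, **`1 ≤ classicalLambda κ ≤ rank₂ Cl(F_n)`** (the `λ`-reading of the cubic `hRank` ledger).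
[cite: Fukuda1994, Thm. 1 (2), p. 264] [cite: Washington1997, §13.3 Prop. 13.23 and Thm. 13.13] [cite: Lang1990, Ch. 13 §4, Lemma 4.1] -/
theorem one_le_classicalLambda_and_le_of_rankCert_of_cubic (hF : Module.finrank ℚ F = 3) (h1 : InfinitePlace.nrRealPlaces F = 1)
    (h3 : 3 ≤ {v : HeightOneSpectrum (𝓞 F) | ((2 : ℕ) : 𝓞 F) ∈ v.asIdeal}.ncard)
    (κ : ZpExtension F 2) (hκ : κ.IsCyclotomic) {n : ℕ} (hcert : classGroupPRank κ (n + 1) = classGroupPRank κ n) :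
    ClassicalMuVanishes κ ∧ 1 ≤ classicalLambda κ ∧ classicalLambda κ ≤ classGroupPRank κ n := by
  haveI : Fact (Nat.Prime 2) := ⟨Nat.prime_two⟩
  obtain ⟨hμ, hle⟩ := classicalLambda_le_of_classGroupPRank_succ_eq κ (totallyRamifiedFrom_zero_of_cubic F hF h3 κ hκ) (Nat.zero_le n) hcert
  exact ⟨hμ, one_le_classicalLambda_of_cubic F hF h1 h3 κ hκ hμ, hle⟩

/-- **A cubic certificate of value `1` pins `λ₂(F^{cyc}) = 1`.** [cite: Fukuda1994, Thm. 1 (2), p. 264] [cite: Washington1997, §13.3 Thm. 13.13] -/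
theorem classicalLambda_eq_one_of_rankCert_eq_one_of_cubic (hF : Module.finrank ℚ F = 3) (h1 : InfinitePlace.nrRealPlaces F = 1)
    (h3 : 3 ≤ {v : HeightOneSpectrum (𝓞 F) | ((2 : ℕ) : 𝓞 F) ∈ v.asIdeal}.ncard)
    (κ : ZpExtension F 2) (hκ : κ.IsCyclotomic) {n : ℕ} (hcert : classGroupPRank κ (n + 1) = classGroupPRank κ n)
    (hr : classGroupPRank κ n = 1) : classicalLambda κ = 1 := by
  obtain ⟨-, hge, hle⟩ := one_le_classicalLambda_and_le_of_rankCert_of_cubic F hF h1 h3 κ hκ hcert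
  omega

/-- **No cubic certificate of value `0`**: `rank₂ Cl(F_n) = 0` (odd class number at layer `n`) ⟹ `rank₂ Cl(F_{n+1}) ≠ 0` — the `2`-class group of `F_{n+1}` is
non-trivial (REF1 R296a in certificate form, every `n ≥ 0`). [cite: Fukuda1994, Thm. 1 (2), p. 264] [cite: Lang1990, Ch. 13 §4, Lemma 4.1] -/
theorem classGroupPRank_succ_ne_of_eq_zero_of_cubic (hF : Module.finrank ℚ F = 3) (h1 : InfinitePlace.nrRealPlaces F = 1)
    (h3 : 3 ≤ {v : HeightOneSpectrum (𝓞 F) | ((2 : ℕ) : 𝓞 F) ∈ v.asIdeal}.ncard)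
    (κ : ZpExtension F 2) (hκ : κ.IsCyclotomic) {n : ℕ} (h0 : classGroupPRank κ n = 0) :
    classGroupPRank κ (n + 1) ≠ classGroupPRank κ n := fun hcert ↦ by
  obtain ⟨-, hge, hle⟩ := one_le_classicalLambda_and_le_of_rankCert_of_cubic F hF h1 h3 κ hκ hcert
  omega

end Cubic

/-! ## §4 The Greenberg field (imaginary quadratic, `2` split): `1 ≤ λ ≤ r`, `r = 1 ⟹ λ = 1` -/

section Greenberg

variable {K : Type} [Field K] [NumberField K]

/-- Fukuda index `0` for an imaginary quadratic field in which `2` splits (both dyadic primes totally ramified in the cyclotomic `ℤ₂`-extension).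
[cite: Washington1997, §13.1 Lemma 13.3] [cite: Fukuda1994, p. 264] -/
theorem totallyRamifiedFrom_zero_of_isImaginaryQuadratic (hK : IsImaginaryQuadratic K) (h2 : SplitsCompletely K 2)
    (κ : ZpExtension K 2) (hκ : κ.IsCyclotomic) : TotallyRamifiedFrom κ 0 := by
  have h4 : ¬ 4 ∣ Module.finrank ℚ K := by rw [hK.1]; decide
  have hodd : ∀ w : HeightOneSpectrum (𝓞 K), ((2 : ℕ) : 𝓞 K) ∈ w.asIdeal → Odd (w.asIdeal.ramificationIdx ℤ) := fun w hw ↦ by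
    rw [forall_ramificationIdx_eq_one_of_splitsCompletely_two h2 w hw]; exact odd_one
  obtain ⟨θ₁, hθ₁⟩ := exists_sq_eq_two_layer_one_of_forall_sq_ne_two h4 (forall_sq_ne_two_of_forall_odd_ramificationIdx hodd) κ hκ
  exact totallyRamifiedFrom_zero_of_sq_eq_two κ hθ₁ hodd

/-- ★ **`1 ≤ λ₂ ≤ r` from a rank certificate on the Greenberg field**: `K` imaginary quadratic with `2` split, `κ` cyclotomic, `rank₂ Cl(K_{n+1}) = rank₂ Cl(K_n)`
⟹ `μ = 0`, **`1 ≤ classicalLambda κ ≤ rank₂ Cl(K_n)`**. [cite: Fukuda1994, Thm. 1 (2), p. 264] [cite: Washington1997, §13.3 Prop. 13.23 and Thm. 13.13]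
[cite: Ferrero1978, §1 (Iwasawa invariants of abelian fields)] -/
theorem one_le_classicalLambda_and_le_of_rankCert_of_isImaginaryQuadratic (hK : IsImaginaryQuadratic K) (h2 : SplitsCompletely K 2)
    (κ : ZpExtension K 2) (hκ : κ.IsCyclotomic) {n : ℕ} (hcert : classGroupPRank κ (n + 1) = classGroupPRank κ n) :
    ClassicalMuVanishes κ ∧ 1 ≤ classicalLambda κ ∧ classicalLambda κ ≤ classGroupPRank κ n := by
  haveI : Fact (Nat.Prime 2) := ⟨Nat.prime_two⟩
  obtain ⟨hμ, hle⟩ := classicalLambda_le_of_classGroupPRank_succ_eq κ (totallyRamifiedFrom_zero_of_isImaginaryQuadratic hK h2 κ hκ)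
    (Nat.zero_le n) hcert
  exact ⟨hμ, one_le_classicalLambda_of_isImaginaryQuadratic hK h2 κ hκ hμ, hle⟩

/-- **A Greenberg-field certificate of value `1` pins `λ₂(K^{cyc}) = 1`** (e.g. `rank₂ Cl(K) = rank₂ Cl(K(√2)) = 1`).
[cite: Fukuda1994, Thm. 1 (2), p. 264] [cite: Washington1997, §13.3 Thm. 13.13] -/
theorem classicalLambda_eq_one_of_rankCert_eq_one_of_isImaginaryQuadratic (hK : IsImaginaryQuadratic K) (h2 : SplitsCompletely K 2)
    (κ : ZpExtension K 2) (hκ : κ.IsCyclotomic) {n : ℕ} (hcert : classGroupPRank κ (n + 1) = classGroupPRank κ n)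
    (hr : classGroupPRank κ n = 1) : classicalLambda κ = 1 := by
  obtain ⟨-, hge, hle⟩ := one_le_classicalLambda_and_le_of_rankCert_of_isImaginaryQuadratic hK h2 κ hκ hcert
  omega

/-- **No Greenberg-field certificate of value `0`**: `rank₂ Cl(K_n) = 0` ⟹ `rank₂ Cl(K_{n+1}) ≠ 0`. [cite: Fukuda1994, Thm. 1 (2), p. 264]
[cite: Washington1997, §13.3 Thm. 13.13] -/
theorem classGroupPRank_succ_ne_of_eq_zero_of_isImaginaryQuadratic (hK : IsImaginaryQuadratic K) (h2 : SplitsCompletely K 2)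
    (κ : ZpExtension K 2) (hκ : κ.IsCyclotomic) {n : ℕ} (h0 : classGroupPRank κ n = 0) :
    classGroupPRank κ (n + 1) ≠ classGroupPRank κ n := fun hcert ↦ by
  obtain ⟨-, hge, hle⟩ := one_le_classicalLambda_and_le_of_rankCert_of_isImaginaryQuadratic hK h2 κ hκ hcert
  omega

end Greenberg

end Summit.BirchSwinnertonDyer.BirchSwinnertonDyer.Theorems.AlignedTransportAtTwoRankCertificateLambda
end
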